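import Mathlib
import Summits.KontsevichZagierPeriods.Zeta5Search.ClassTypeGuardsPeriodic
import HarnessLib

/-!
# ζ(5) search — PERIODIC CLASS-TYPE COVERS II: law A3 (`checkI`) under run dilation, and typing run words (fam-denom g14)

HONEST FRAMING: systematic search; no irrationality claim unless certified.  Cell `pub-zeta5`, family-designer seat fam-denom
(denominator arithmetic), generation 14.  Valuation combinatorics of rationals only; every kernel exponent these feed stays `< 1`.

Continuation of `ClassTypeGuardsPeriodic`: §4 the `isRaise` clause of law A3 survives dilation — STRUCTURAL RAISE CERTIFICATES
`praise` (a point moved across a boundary of runs of depths `d, d + 1`: `pmove`; a run split around one raised point: `psplit`;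
a leading / trailing `1`: `pcons1`), `isRaise_rdecode_of_praise`, and the `t`-free check `pcheckI` with `checkI_pdec`; §5 typing a
run word run by run: `levels_run` (ONE `Levels` run from a level-region fact and two end-point inequalities linear in `p` and
`P = t·p`), `levels_run2` (a run crossing two regions of equal depth), `levels_run_nil`, `levels_run_start`.  Consumers: the
per-cell `∀ t` cover files `RayC1Periodic*`.
-/

namespace Summit.KontsevichZagierPeriods.Zeta5Search.ClassTypeCover

open Summit.KontsevichZagierPeriods.Zeta5Search.SecondOrder (isRaise)
open Summit.KontsevichZagierPeriods.Zeta5Search.ClusterValuation (netExp)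

/-! ## §4 Law A3 (`checkI`): dilation-stable raise certificates -/

/-- From a positional raise witness `T = A ++ d :: B`, `S = A ++ (d+1) :: B` to `isRaise T S`. -/
theorem isRaise_of_raisedAt {T S : List ℤ} (h : ∃ A B : List ℤ, ∃ d : ℤ, T = A ++ d :: B ∧ S = A ++ (d + 1) :: B) :
    isRaise T S = true := by
  obtain ⟨A, B, d, rfl, rfl⟩ := h
  exact isRaise_of_split A B d

/-- A positional raise survives a common prefix. -/
theorem raisedAt_append_left {T S : List ℤ} (P : List ℤ)
    (h : ∃ A B : List ℤ, ∃ d : ℤ, T = A ++ d :: B ∧ S = A ++ (d + 1) :: B) :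
    ∃ A B : List ℤ, ∃ d : ℤ, P ++ T = A ++ d :: B ∧ P ++ S = A ++ (d + 1) :: B := by
  obtain ⟨A, B, d, rfl, rfl⟩ := h
  exact ⟨P ++ A, B, d, by simp, by simp⟩

/-- Transfer to the right: `d^{k+1+st} (d+1)^{l'+s't} X ↦ d^{k+st} (d+1)^{l'+1+s't} X`. -/
theorem raisedAt_moveR (d : ℤ) (k s l' s' t : ℕ) (X : List ℤ) :
    ∃ A B : List ℤ, ∃ d₀ : ℤ, List.replicate (k + 1 + s * t) d ++ (List.replicate (l' + s' * t) (d + 1) ++ X) = A ++ d₀ :: B ∧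
      List.replicate (k + s * t) d ++ (List.replicate (l' + 1 + s' * t) (d + 1) ++ X) = A ++ (d₀ + 1) :: B := by
  refine ⟨List.replicate (k + s * t) d, List.replicate (l' + s' * t) (d + 1) ++ X, d, ?_, ?_⟩
  · rw [show k + 1 + s * t = (k + s * t) + 1 by ring, List.replicate_succ', List.append_assoc]; rfl
  · rw [show l' + 1 + s' * t = (l' + s' * t) + 1 by ring, List.replicate_succ]; rfl

/-- Transfer to the left: `(d+1)^{l+st} d^{k'+1+s't} X ↦ (d+1)^{l+1+st} d^{k'+s't} X`. -/
theorem raisedAt_moveL (d : ℤ) (l s k' s' t : ℕ) (X : List ℤ) :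
    ∃ A B : List ℤ, ∃ d₀ : ℤ, List.replicate (l + s * t) (d + 1) ++ (List.replicate (k' + 1 + s' * t) d ++ X) = A ++ d₀ :: B ∧
      List.replicate (l + 1 + s * t) (d + 1) ++ (List.replicate (k' + s' * t) d ++ X) = A ++ (d₀ + 1) :: B := by
  refine ⟨List.replicate (l + s * t) (d + 1), List.replicate (k' + s' * t) d ++ X, d, ?_, ?_⟩
  · rw [show k' + 1 + s' * t = (k' + s' * t) + 1 by ring, List.replicate_succ]; rfl
  · rw [show l + 1 + s * t = (l + s * t) + 1 by ring, List.replicate_succ', List.append_assoc]; rfl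

/-- Split of one run around a raised point: `d^{l₁+1+l₂+(s₁+s₂)t} X ↦ d^{l₁+s₁t} (d+1) d^{l₂+s₂t} X`. -/
theorem raisedAt_split (d : ℤ) (l₁ s₁ l₂ s₂ t : ℕ) (X : List ℤ) :
    ∃ A B : List ℤ, ∃ d₀ : ℤ, List.replicate (l₁ + 1 + l₂ + (s₁ + s₂) * t) d ++ X = A ++ d₀ :: B ∧
      List.replicate (l₁ + s₁ * t) d ++ (List.replicate (1 + 0 * t) (d + 1) ++ (List.replicate (l₂ + s₂ * t) d ++ X)) =
        A ++ (d₀ + 1) :: B := by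
  refine ⟨List.replicate (l₁ + s₁ * t) d, List.replicate (l₂ + s₂ * t) d ++ X, d, ?_, ?_⟩
  · rw [show l₁ + 1 + l₂ + (s₁ + s₂) * t = (l₁ + s₁ * t) + ((l₂ + s₂ * t) + 1) by ring, List.replicate_add,
      List.replicate_succ, List.append_assoc, List.cons_append]
  · simp

/-- MOVE CERTIFICATE on the first two runs: one point transferred between two adjacent runs of depths `d → d+1`
(rightwards) or `d+1 ← d` (leftwards), slopes and remainders equal. -/
def pmove (r : Run) (R₀ : List Run) (e : Run) (R : List Run) : Bool :=
  match R₀, R with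
  | r' :: R₀', e' :: R' =>
      decide (e.1 = r.1) && decide (e.2.2 = r.2.2) && decide (e'.1 = r'.1) && decide (e'.2.2 = r'.2.2) &&
        decide (R' = R₀') &&
        ((decide (r'.1 = r.1 + 1) && decide (e.2.1 + 1 = r.2.1) && decide (e'.2.1 = r'.2.1 + 1)) ||
          (decide (r.1 = r'.1 + 1) && decide (e.2.1 = r.2.1 + 1) && decide (e'.2.1 + 1 = r'.2.1)))
  | _, _ => false

/-- SPLIT CERTIFICATE on the first run: the run `(d, l, s)` replaced by `(d, l₁, s₁), (d+1, 1, 0), (d, l₂, s₂)` with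
`l₁ + 1 + l₂ = l`, `s₁ + s₂ = s`, remainders equal. -/
def psplit (r : Run) (R₀ : List Run) (e : Run) (R : List Run) : Bool :=
  match R with
  | e' :: e'' :: R' =>
      decide (e.1 = r.1) && decide (e'.1 = r.1 + 1) && decide (e'.2.1 = 1) && decide (e'.2.2 = 0) &&
        decide (e''.1 = r.1) && decide (e.2.1 + 1 + e''.2.1 = r.2.1) && decide (e.2.2 + e''.2.2 = r.2.2) &&
        decide (R' = R₀)
  | _ => false

/-- RAISE CERTIFICATE on run words, checked run by run: a move or a split at the current position, or equal first runs
and a certificate on the tails.  Sound at every dilation parameter (`isRaise_rdecode_of_praiseR`). -/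
def praiseR : List Run → List Run → Bool
  | r :: R₀, e :: R => pmove r R₀ e R || psplit r R₀ e R || (decide (e = r) && praiseR R₀ R)
  | _, _ => false

/-- A `pmove` certificate (a unit moved across a boundary of runs of depths `d, d + 1`) gives a positional raise at every `t`. -/
theorem raisedAt_of_pmove {r : Run} {R₀ : List Run} {e : Run} {R : List Run} (h : pmove r R₀ e R = true) (t : ℕ) :
    ∃ A B : List ℤ, ∃ d₀ : ℤ, rdecode (r :: R₀) t = A ++ d₀ :: B ∧ rdecode (e :: R) t = A ++ (d₀ + 1) :: B := by
  obtain ⟨d, l, s⟩ := r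
  obtain ⟨e₁, k, u⟩ := e
  match R₀, R, h with
  | [], [], h => simp [pmove] at h
  | [], _ :: _, h => simp [pmove] at h
  | _ :: _, [], h => simp [pmove] at h
  | (d', l', s') :: R₀', (e₁', k', u') :: R', h =>
      simp only [pmove, Bool.and_eq_true, Bool.or_eq_true, decide_eq_true_eq] at h
      obtain ⟨⟨⟨⟨⟨h1, h2⟩, h3⟩, h4⟩, h5⟩, hmv⟩ := h
      subst h1 h2 h3 h4 h5
      rcases hmv with ⟨⟨hd, hk⟩, hk'⟩ | ⟨⟨hd, hk⟩, hk'⟩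
      · subst hd hk hk'
        simp only [rdecode_cons]
        exact raisedAt_moveR _ _ _ _ _ t _
      · subst hd hk hk'
        simp only [rdecode_cons]
        exact raisedAt_moveL _ _ _ _ _ t _

/-- A `psplit` certificate (a run split around one raised unit) gives a positional raise at every `t`. -/
theorem raisedAt_of_psplit {r : Run} {R₀ : List Run} {e : Run} {R : List Run} (h : psplit r R₀ e R = true) (t : ℕ) :
    ∃ A B : List ℤ, ∃ d₀ : ℤ, rdecode (r :: R₀) t = A ++ d₀ :: B ∧ rdecode (e :: R) t = A ++ (d₀ + 1) :: B := by
  obtain ⟨d, l, s⟩ := r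
  obtain ⟨e₁, k, u⟩ := e
  match R, h with
  | [], h => simp [psplit] at h
  | [_], h => simp [psplit] at h
  | (f₁, k₁, u₁) :: (f₂, k₂, u₂) :: R', h =>
      simp only [psplit, Bool.and_eq_true, decide_eq_true_eq] at h
      obtain ⟨⟨⟨⟨⟨⟨⟨h1, h2⟩, h3⟩, h4⟩, h5⟩, h6⟩, h7⟩, h8⟩ := h
      subst h1 h2 h3 h4 h5 h6 h7 h8
      simp only [rdecode_cons]
      exact raisedAt_split _ _ _ _ _ t _

/-- A `praiseR` certificate (common prefix, then `pmove` or `psplit`) gives a positional raise at every `t`. -/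
theorem raisedAt_of_praiseR : ∀ (R₀ R : List Run), praiseR R₀ R = true → ∀ t : ℕ,
    ∃ A B : List ℤ, ∃ d₀ : ℤ, rdecode R₀ t = A ++ d₀ :: B ∧ rdecode R t = A ++ (d₀ + 1) :: B
  | [], [], h, _ => by simp [praiseR] at h
  | [], _ :: _, h, _ => by simp [praiseR] at h
  | _ :: _, [], h, _ => by simp [praiseR] at h
  | r :: R₀, e :: R, h, t => by
      rw [praiseR, Bool.or_eq_true, Bool.or_eq_true] at h
      rcases h with (h | h) | h
      · exact raisedAt_of_pmove h t
      · exact raisedAt_of_psplit h t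
      · simp only [Bool.and_eq_true, decide_eq_true_eq] at h
        obtain ⟨h1, h2⟩ := h
        rw [h1, rdecode_cons, rdecode_cons]
        exact raisedAt_append_left _ (raisedAt_of_praiseR R₀ R h2 t)

/-- `praiseR R₀ R` ⇒ `isRaise (rdecode R₀ t) (rdecode R t)` for every `t`. -/
theorem isRaise_rdecode_of_praiseR {R₀ R : List Run} (h : praiseR R₀ R = true) (t : ℕ) :
    isRaise (rdecode R₀ t) (rdecode R t) = true :=
  isRaise_of_raisedAt (raisedAt_of_praiseR R₀ R h t)

/-- LEADING-`+1` CERTIFICATE: the first run has depth `1` and becomes one longer, slopes and remainders equal. -/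
def pcons1 : List Run → List Run → Bool
  | r :: R₀, e :: R => decide (r.1 = 1) && decide (e.1 = 1) && decide (e.2.1 = r.2.1 + 1) && decide (e.2.2 = r.2.2) &&
      decide (R = R₀)
  | _, _ => false

/-- A `pcons1` certificate: `R` decodes to `1 :: rdecode R₀ t` at every `t`. -/
theorem rdecode_of_pcons1 : ∀ {R₀ R : List Run}, pcons1 R₀ R = true → ∀ t : ℕ, rdecode R t = 1 :: rdecode R₀ t
  | [], [], h, _ => by simp [pcons1] at h
  | [], _ :: _, h, _ => by simp [pcons1] at h
  | _ :: _, [], h, _ => by simp [pcons1] at h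
  | (d, l, s) :: R₀, (e₁, k, u) :: R, h, t => by
      simp only [pcons1, Bool.and_eq_true, decide_eq_true_eq] at h
      obtain ⟨⟨⟨⟨h1, h2⟩, h3⟩, h4⟩, h5⟩ := h
      subst h1 h2 h3 h4 h5
      simp only [rdecode_cons]
      rw [Nat.add_right_comm, List.replicate_succ, List.cons_append]

/-- FULL RAISE CERTIFICATE: leading `+1`, trailing `+1` (= leading on the mirror words), or `praiseR`. -/
def praise (R₀ R : List Run) : Bool := pcons1 R₀ R || pcons1 R₀.reverse R.reverse || praiseR R₀ R

/-- **A certified raise is a raise at every dilation parameter.** -/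
theorem isRaise_rdecode_of_praise {R₀ R : List Run} (h : praise R₀ R = true) (t : ℕ) :
    isRaise (rdecode R₀ t) (rdecode R t) = true := by
  rw [praise, Bool.or_eq_true, Bool.or_eq_true] at h
  rcases h with (h | h) | h
  · have he := rdecode_of_pcons1 h t
    unfold isRaise
    rw [Bool.or_eq_true, Bool.or_eq_true]
    exact Or.inl (Or.inr (by rw [he]; exact beq_self_eq_true _))
  · have he := rdecode_of_pcons1 h t
    rw [← rdecode_reverse, ← rdecode_reverse, List.reverse_eq_iff] at he
    unfold isRaise
    rw [Bool.or_eq_true, Bool.or_eq_true]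
    refine Or.inr ?_
    rw [he]
    simp
  · exact isRaise_rdecode_of_praiseR h t

/-- `t`-free form of `checkI` at `(M₀ + νt; rdecode R₀ t)`: every type multipole with sum slope `−ν`, `−M₀ ≤ E₀`, the entries
at base level `−M₀` centre-free with run word `R₀`, those at `−M₀ + 1` certified raises of `R₀` or the odd centre class on `R₀`. -/
def pcheckI (odd : Bool) (RC : List PRun) (ν M₀ : ℕ) (R₀ : List Run) : Bool :=
  RC.all fun rc => decide (2 ≤ rpoles0 rc.1) && decide (rslope rc.1 = -(ν : ℤ)) && decide (-(M₀ : ℤ) ≤ pexp0 odd rc) &&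
    (!decide (pexp0 odd rc = -(M₀ : ℤ)) || (!rc.2 && decide (rc.1 = R₀))) &&
    (!decide (pexp0 odd rc = -(M₀ : ℤ) + 1) || (praise R₀ rc.1 || (odd && rc.2 && decide (rc.1 = R₀))))

/-- **`checkI` (the law-A3 guard) at every `t`.** -/
theorem checkI_pdec {odd : Bool} {RC : List PRun} {ν M₀ : ℕ} {R₀ : List Run} (h : pcheckI odd RC ν M₀ R₀ = true) (t : ℕ) :
    checkI odd (RC.map (pdec t)) (M₀ + ν * t) (rdecode R₀ t) = true := by
  rw [checkI, List.all_eq_true]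
  intro tc htc
  obtain ⟨rc, hrc, rfl⟩ := List.mem_map.1 htc
  rw [pcheckI, List.all_eq_true] at h
  have hc := h rc hrc
  simp only [Bool.and_eq_true, Bool.or_eq_true, Bool.not_eq_true', decide_eq_true_eq, decide_eq_false_iff_not] at hc
  obtain ⟨⟨⟨⟨h2, hσ⟩, hM⟩, hx⟩, hy⟩ := hc
  have hE := expL_pdec odd rc t
  rw [hσ] at hE
  have hP := two_le_polesL_pdec h2 t
  have hν := nuL_pdec h2 odd t
  have hMt : (-((M₀ + ν * t : ℕ) : ℤ)) = -(M₀ : ℤ) + -(ν : ℤ) * t := by push_cast; ring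
  refine Bool.and_eq_true_iff.2 ⟨Bool.and_eq_true_iff.2 ⟨Bool.and_eq_true_iff.2 ⟨?_, ?_⟩, ?_⟩, ?_⟩
  · rw [Bool.or_eq_true, decide_eq_true_eq, decide_eq_true_eq, hE, hMt]
    exact Or.inr (by linarith)
  · have hne : decide (polesL (pdec t rc).1 = 1) = false := decide_eq_false (by omega)
    rw [hne]; rfl
  · rcases hx with hne | ⟨hc0, hR⟩
    · have heq : decide (expL odd (pdec t rc).1 (pdec t rc).2 = -((M₀ + ν * t : ℕ) : ℤ)) = false :=
        decide_eq_false (by rw [hE, hMt]; intro hh; exact hne (by linarith))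
      rw [heq]; simp
    · have hc1 : (pdec t rc).2 = false := hc0
      have hT : decide ((pdec t rc).1 = rdecode R₀ t) = true := decide_eq_true (by rw [pdec_fst, hR])
      rw [hc1, hT]; simp
  · rcases hy with hne | hpr | ⟨⟨ho, hc0⟩, hR⟩
    · have heq : decide (nuL odd (pdec t rc).1 (pdec t rc).2 = -((M₀ + ν * t : ℕ) : ℤ) + 1) = false :=
        decide_eq_false (by rw [hν, hE, hMt]; intro hh; exact hne (by linarith))
      rw [heq]; simp
    · have hr : isRaise (rdecode R₀ t) (pdec t rc).1 = true := by
        rw [pdec_fst]; exact isRaise_rdecode_of_praise hpr t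
      rw [hr]; simp
    · have hc1 : (pdec t rc).2 = true := hc0
      have hT : decide ((pdec t rc).1 = rdecode R₀ t) = true := decide_eq_true (by rw [pdec_fst, hR])
      rw [hc1, hT, ho]; simp


/-! ## §5 Typing run words: `Levels` run by run, with end-point hypotheses linear in `P = t·p` -/

/-- Base length `Σ l`. -/
def rlen0 : List Run → ℕ
  | [] => 0
  | r :: R => r.2.1 + rlen0 R

/-- Length slope `Σ s`. -/
def rlslope : List Run → ℕ
  | [] => 0
  | r :: R => r.2.2 + rlslope R

/-- The length of a decoded run word is affine in `t`: `rlen0 R + rlslope R * t`. -/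
theorem rdecode_length (R : List Run) (t : ℕ) : (rdecode R t).length = rlen0 R + rlslope R * t := by
  induction R with
  | nil => simp [rlen0, rlslope]
  | cons r R ih => rw [rdecode_cons, List.length_append, List.length_replicate, ih, rlen0, rlslope]; ring

/-- `Levels` of a concatenation from `Levels` of the two pieces at consecutive positions. -/
theorem levels_append {b : ℕ → ℤ} {q p : ℕ} {T S : List ℤ} (hT : Levels b q p T)
    (hS : Levels b (q + T.length * p) p S) : Levels b q p (T ++ S) := by
  intro k hk
  rw [List.length_append] at hk
  rw [List.getD_eq_getElem?_getD]
  by_cases hkT : k < T.length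
  · rw [List.getElem?_append_left hkT, ← List.getD_eq_getElem?_getD]
    exact hT k hkT
  · obtain ⟨j, rfl⟩ : ∃ j, k = T.length + j := ⟨k - T.length, by omega⟩
    rw [List.getElem?_append_right (by omega), Nat.add_sub_cancel_left, ← List.getD_eq_getElem?_getD,
      ← hS j (by omega)]
    congr 1
    ring

/-- `Levels` of a constant run from a pointwise level fact along the run. -/
theorem levels_replicate {b : ℕ → ℤ} {q p len : ℕ} {d : ℤ} (h : ∀ k, k < len → netExp b (q + k * p) = d) :
    Levels b q p (List.replicate len d) := by
  intro k hk
  rw [List.length_replicate] at hk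
  rw [h k hk, List.getD_eq_getElem?_getD, List.getElem?_replicate, if_pos hk]
  rfl

/-- **ONE RUN**: `Levels` for `(d, l, s) :: R` at the class point of index `K + S·t` from a region fact
`lo ≤ 2q → 2q + 2 ≤ hi → netExp b q = d` (doubled bounds, so that half-integral centres are expressible), the two END-POINT
inequalities — linear in `p` and `P = t·p` — and `Levels` for the remaining runs from index `(K + l) + (S + s)·t`. -/
theorem levels_run {b : ℕ → ℤ} {x p t P : ℕ} (hP : t * p = P) {lo hi : ℕ} {d : ℤ}
    (hreg : ∀ q, lo ≤ 2 * q → 2 * q + 2 ≤ hi → netExp b q = d) {K S l s : ℕ} {R : List Run}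
    (h1 : lo ≤ 2 * (x + K * p + S * P)) (h2 : 2 * (x + (K + l) * p + (S + s) * P) + 2 ≤ hi + 2 * p)
    (hrest : Levels b (x + ((K + l) + (S + s) * t) * p) p (rdecode R t)) :
    Levels b (x + (K + S * t) * p) p (rdecode ((d, l, s) :: R) t) := by
  have eK : (K + S * t) * p = K * p + S * P := by rw [← hP]; ring
  have eL : x + (K + S * t) * p + (List.replicate (l + s * t) d).length * p = x + ((K + l) + (S + s) * t) * p := by
    rw [List.length_replicate]; ring
  rw [rdecode_cons]
  dsimp only
  refine levels_append (levels_replicate ?_) (by rw [eL]; exact hrest)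
  intro k hk
  have hk' : k * p + p ≤ l * p + s * P := by
    have hm := Nat.mul_le_mul_right p (show k + 1 ≤ l + s * t by omega)
    have e2 : (l + s * t) * p = l * p + s * P := by rw [← hP]; ring
    rw [e2] at hm
    linarith
  simp only [add_mul] at h2
  refine hreg _ ?_ ?_
  · rw [eK]; omega
  · rw [eK]; omega

/-- **TWO SUB-RUNS, ONE RUN**: as `levels_run`, for a run typed in two pieces `l₁ + s₁t`, `l₂ + s₂t` lying in two regions of
the same depth (the well on both sides of the centre, for a class avoiding the centre). -/
theorem levels_run2 {b : ℕ → ℤ} {x p t P : ℕ} (hP : t * p = P) {lo₁ hi₁ lo₂ hi₂ : ℕ} {d : ℤ}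
    (hreg₁ : ∀ q, lo₁ ≤ 2 * q → 2 * q + 2 ≤ hi₁ → netExp b q = d)
    (hreg₂ : ∀ q, lo₂ ≤ 2 * q → 2 * q + 2 ≤ hi₂ → netExp b q = d) {K S l₁ s₁ l₂ s₂ : ℕ} {R : List Run}
    (h1 : lo₁ ≤ 2 * (x + K * p + S * P)) (h2 : 2 * (x + (K + l₁) * p + (S + s₁) * P) + 2 ≤ hi₁ + 2 * p)
    (h3 : lo₂ ≤ 2 * (x + (K + l₁) * p + (S + s₁) * P))
    (h4 : 2 * (x + (K + l₁ + l₂) * p + (S + s₁ + s₂) * P) + 2 ≤ hi₂ + 2 * p)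
    (hrest : Levels b (x + ((K + (l₁ + l₂)) + (S + (s₁ + s₂)) * t) * p) p (rdecode R t)) :
    Levels b (x + (K + S * t) * p) p (rdecode ((d, l₁ + l₂, s₁ + s₂) :: R) t) := by
  have h := levels_run hP hreg₁ h1 h2 (R := (d, l₂, s₂) :: R)
    (levels_run hP hreg₂ (K := K + l₁) (S := S + s₁) (by simp only [add_mul] at h3 ⊢; omega)
      (by simp only [add_mul] at h4 ⊢; omega)
      (by rw [show K + l₁ + l₂ + (S + s₁ + s₂) * t = K + (l₁ + l₂) + (S + (s₁ + s₂)) * t by ring]; exact hrest))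
  rw [rdecode_cons, rdecode_cons, ← List.append_assoc, List.replicate_append_replicate] at h
  rw [rdecode_cons]
  dsimp only at h ⊢
  rw [show l₁ + l₂ + (s₁ + s₂) * t = l₁ + s₁ * t + (l₂ + s₂ * t) by ring]
  exact h

/-- The end of the run word. -/
theorem levels_run_nil (b : ℕ → ℤ) (x p t K S : ℕ) : Levels b (x + (K + S * t) * p) p (rdecode [] t) :=
  levels_nil b _ p

/-- The start of the run word. -/
theorem levels_run_start {b : ℕ → ℤ} {x p t : ℕ} {R : List Run} (h : Levels b (x + (0 + 0 * t) * p) p (rdecode R t)) :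
    Levels b x p (rdecode R t) := by
  simpa using h

end Summit.KontsevichZagierPeriods.Zeta5Search.ClassTypeCover
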